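import Summits.CriticalPhenomena.PercolationContinuityZ3.Theorems.PercNearOneGluingNoHeavyQuantFarGate3PinchAtlas
import Summits.CriticalPhenomena.PercolationContinuityZ3.Theorems.PercNearOneGluingNoHeavyQuantFarGate3Region_s0_08_0
import Summits.CriticalPhenomena.PercolationContinuityZ3.Theorems.PercNearOneGluingNoHeavyQuantFarGate3Region_s0_08_1
import Summits.CriticalPhenomena.PercolationContinuityZ3.Theorems.PercNearOneGluingNoHeavyQuantFarGate3Region_s0_08_2
import Summits.CriticalPhenomena.PercolationContinuityZ3.Theorems.PercNearOneGluingNoHeavyQuantFarGate3Region_s0_09_0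
import Summits.CriticalPhenomena.PercolationContinuityZ3.Theorems.PercNearOneGluingNoHeavyQuantFarGate3Region_s0_09_1
import Summits.CriticalPhenomena.PercolationContinuityZ3.Theorems.PercNearOneGluingNoHeavyQuantFarGate3SmallPLargeSigma
import HarnessLib

/-!
# QUANT lane R8, front "FAR beyond trees", layer one — THE DEGREE-THREE GATE AT THE OBSERVER, LXXIII: STRIP 0 (`r₁ ≤ 1/10`, `r₂ ≥ 4/5`) below `p = 1/20`,
# modulo the pinch-chart data (`Gate3.red8_strip0_of_data`)

builds on p205010 (kernel theorem, internal audit signed; external expert review pending)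

Support file (`--supports stmt-CriticalPhenomena-4575`), seat `prim-quant-p1` (gen 35); memo
`run/shared/lean/prim/quant/prim-quant-p1-g35/FOR-LEAD-GATE3-PINCH.md`.  The pinch atlas (file LXXII), the five strip-0 chart-C region masters
(`chartC region s0_08_0/1/2`, `s0_09_0/1`, kit j252986/j252989 — the complement of the hole `H`) and T1 (`red8_smallp_largeσ_of_le`, file LIV) only;
standard axioms; no sorries.  GENERATED by `work/chartP/gen_strip0.py`.

For `0 < p < 1/20`, `nn ≥ 1`, `0 ≤ r₁ ≤ 1/10`, `4/5 ≤ r₂ < 1`: with `σ = nn·p`, `u = 1/nn`: `σ ≥ 9/8` is T1; otherwise the point `(σ,u,r₁,r₂)` lies in one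
of the five chart-C regions around the hole `H = [7/8,9/8]×[0,1/8]×[0,1/8]×[13/16,1]` (kernel-checked chart-C certificates) or in `H` itself, where the
five blow-up charts apply (`Gate3.red8_pinch_of_data`) — GIVEN their certificate data `HW … HM` (hypotheses here; discharged by the chart masters).
[this work].
-/

namespace Summit.CriticalPhenomena.PercolationContinuityZ3.Theorems

namespace Quant

namespace Gate3

set_option maxHeartbeats 4000000 in
/-- **Strip 0 modulo the pinch data**, case `r₁ ≤ r₂`: `0 < p < 1/20`, `nn ≥ 1`, `0 ≤ r₁ ≤ 1/10`, `4/5 ≤ r₂ < 1`. [this work] -/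
theorem red8_strip0_of_data (p r₁ r₂ nn : ℝ) (hp0 : 0 < p) (hp : p < (1 : ℝ) / 20) (hr10 : 0 ≤ r₁) (h1hi : r₁ ≤ (1 : ℝ) / 10)
    (h2lo : (4 : ℝ) / 5 ≤ r₂) (hr2 : r₂ < 1) (hn : 1 ≤ nn)
    (HW : CertN.BoxOKR PinchW.spec (0 : ℝ) ((3 : ℝ) / 16) (0 : ℝ) (1 : ℝ) (0 : ℝ) (1 : ℝ) (-3 : ℝ) (3 : ℝ))
    (HR : CertN.BoxOKR PinchR.spec (0 : ℝ) ((1 : ℝ) / 8) (0 : ℝ) (1 : ℝ) (0 : ℝ) (1 : ℝ) (-3 : ℝ) (3 : ℝ))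
    (HU : CertN.BoxOKR PinchU.spec (0 : ℝ) ((1 : ℝ) / 8) (0 : ℝ) (1 : ℝ) (0 : ℝ) (1 : ℝ) (-3 : ℝ) (3 : ℝ))
    (HP : CertN.BoxOKR PinchP.spec (0 : ℝ) ((1 : ℝ) / 8) (0 : ℝ) ((1 : ℝ) / 3) (0 : ℝ) ((1 : ℝ) / 3) (0 : ℝ) ((1 : ℝ) / 3))
    (HM : CertN.BoxOKR PinchM.spec (0 : ℝ) ((1 : ℝ) / 8) (0 : ℝ) ((1 : ℝ) / 3) (0 : ℝ) ((1 : ℝ) / 3) (0 : ℝ) ((1 : ℝ) / 3)) :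
    ∀ (a0 a1 a2 b1 b2 c0 c1 d : ℝ), 0 ≤ a0 → 0 ≤ a1 → 0 ≤ a2 → 0 ≤ b1 → 0 ≤ b2 → 0 ≤ c0 → 0 ≤ c1 → 0 ≤ d →
    b1 * (b2 + (c0 + c1)) ≤ (a0 + a1 + a2) * d →
    b2 * (b1 + (c0 + c1)) ≤ (a0 + a1 + a2) * d →
    (c0 + c1) * (b1 + b2) ≤ (a0 + a1 + a2) * d →
    b1 * (a1 + a2 + c1 + d) ≤ d * (a0 + b1 + b2 + c0) →
    b2 * (a1 + a2 + c1 + d) ≤ d * (a0 + b1 + b2 + c0) →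
    c0 * (a1 + a2 + c1 + d) ≤ (c1 + d) * (a0 + b1 + b2 + c0) →
    0 < p * ((1 - r₁) * (1 - r₂)) * (a0 + c0) - (1 - p) * a2 - (1 - p) * ((1 - r₁) * (1 - r₂)) * d →
    0 < (1 - p) * (1 - r₁) * b1 - p * (r₂ * (1 - r₁)) * a0 - p * (1 - r₁) * a1 - (1 - p * r₁) * a2 - (1 - (1 - p) * (1 - r₂)) * (1 - r₁) * b2 - p * ((1 - r₁) * (1 - r₂)) * c1 →
    0 < (1 - p) * (1 - r₂) * b2 - p * (r₁ * (1 - r₂)) * a0 - p * (1 - r₂) * a1 - (1 - p * r₂) * a2 - (1 - (1 - p) * (1 - r₁)) * (1 - r₂) * b1 - p * ((1 - r₁) * (1 - r₂)) * c1 →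
    0 < (1 - p * max r₁ r₂ - nn * p * (1 - max r₁ r₂)) * a1 + (1 - p * (r₁ + r₂ * (1 - r₁)) - nn * p * ((1 - r₁) * (1 - r₂))) * c1 - nn * p * (r₁ + r₂ * (1 - r₁) - max r₁ r₂) * a0 - nn * ((1 - (1 - p) * (1 - r₁)) * (1 - r₂)) * b1 - nn * ((1 - (1 - p) * (1 - r₂)) * (1 - r₁)) * b2 →
    0 < (p * (1 + r₁ + r₂ + nn * max r₁ r₂) - 2) * a0 + (p * (1 + r₁ + r₂) + p * max r₁ r₂ * (nn - 1) - 1) * a1 + (p * (1 + r₁ + r₂) + nn - 2) * a2 + ((1 - (1 - p) * (1 - r₁)) * (1 + r₂ * (nn + 1)) - 1) * b1 + ((1 - (1 - p) * (1 - r₂)) * (1 + r₁ * (nn + 1)) - 1) * b2 + (p * (1 + (nn + 2) * (r₁ + r₂ * (1 - r₁))) - 2) * c0 + (p * (1 + (nn + 1) * (r₁ + r₂ * (1 - r₁))) - 1) * c1 + (nn + 1 - (1 - p) * ((1 - r₁) * (1 - r₂))) * d →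
    False
     := by
  have h12 : r₁ ≤ r₂ := by linarith
  have hn0 : 0 < nn := by linarith
  by_cases hT1 : ((9 : ℝ) / 8) ≤ nn * p
  · exact red8_smallp_largeσ_of_le p r₁ r₂ nn hp0 (by linarith) hr10 h12 hr2 hn0.le hT1
  push Not at hT1
  -- chart-C coordinates
  have hσ0 : 0 < nn * p := mul_pos hn0 hp0
  have hu0 : 0 < 1 / nn := by positivity
  have hu1 : 1 / nn ≤ 1 := by rw [div_le_one hn0]; exact hn
  have hσu' : nn * p * (1 / nn) = p := by field_simp
  have hσu : nn * p * (1 / nn) ≤ 1 := by rw [hσu']; linarith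
  have hpp : nn * p * (1 / nn) < (1 : ℝ) / 20 := by rw [hσu']; exact hp
  refine red8_of_chartC p r₁ r₂ nn (nn * p) (1 / nn) hp0 hn0 rfl rfl ?_
  -- generalise the coordinates
  generalize hσ : nn * p = σ at hσ0 hσu hpp hT1
  generalize hu : 1 / nn = u at hu0 hu1 hσu hpp
  by_cases hs : σ ≤ (7 : ℝ) / 8
  · -- left of the hole: regions s0_08_0 / s0_09_0
    rcases le_total r₂ ((9 : ℝ) / 10) with h9 | h9
    · exact chartC_s0_08_0 σ u r₁ r₂ (by linarith) (by linarith) (by linarith) (by linarith) (by linarith) (by linarith) (by linarith) (by linarith) hpp hσ0 hu0 hσu hr10 h12 hr2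
    · exact chartC_s0_09_0 σ u r₁ r₂ (by linarith) (by linarith) (by linarith) (by linarith) (by linarith) (by linarith) (by linarith) (by linarith) hpp hσ0 hu0 hσu hr10 h12 hr2
  push Not at hs
  by_cases huH : (1 : ℝ) / 8 ≤ u
  · -- above the hole in `u`: regions s0_08_1 / s0_09_1 (vacuous: there `σu ≥ 7/64 > 1/20`)
    rcases le_total r₂ ((9 : ℝ) / 10) with h9 | h9
    · exact chartC_s0_08_1 σ u r₁ r₂ (by linarith) (by linarith) (by linarith) (by linarith) (by linarith) (by linarith) (by linarith) (by linarith) hpp hσ0 hu0 hσu hr10 h12 hr2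
    · exact chartC_s0_09_1 σ u r₁ r₂ (by linarith) (by linarith) (by linarith) (by linarith) (by linarith) (by linarith) (by linarith) (by linarith) hpp hσ0 hu0 hσu hr10 h12 hr2
  push Not at huH
  by_cases hrH : r₂ ≤ (13 : ℝ) / 16
  · -- below the hole in `r₂`: region s0_08_2
    exact chartC_s0_08_2 σ u r₁ r₂ (by linarith) (by linarith) (by linarith) (by linarith) (by linarith) (by linarith) (by linarith) (by linarith) hpp hσ0 hu0 hσu hr10 h12 hr2
  push Not at hrH
  -- inside the hole H: the pinch atlas
  have hr1H : r₁ ≤ (1 : ℝ) / 8 := by linarith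
  exact chartC_of_pinchAtlas σ u r₁ r₂ hs.le hT1.le hu0 huH.le hr10 hr1H h12 hrH.le hr2 hσu HW HR HU HP HM

end Gate3

end Quant

end Summit.CriticalPhenomena.PercolationContinuityZ3.Theorems
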